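import Summits.NavierStokesRegularity.FluidComputer.BandFluxCeiling
import Summits.NavierStokesRegularity.FluidComputer.ForwardFluxFloor
import HarnessLib

/-!
# Fluid computer — L17′: the PASS-ON (η) FLOOR of a blow-up (a cascade cannot be uniformly leaky)

HONEST FRAMING (cell `pub-fluidc`, verbatim): *low prior, high value-of-information experiment on Tao's
machine paradigm; NOT a claim that NS blows up.* Theorem side of the cell (necessities every cascade design must
respect); nothing here is evidence of blow-up, and nothing is said about any fixed finite set of levels.

The forward-flux FLOOR L16′ (`ForwardFluxFloor.forward_flux_floor`: `κ ν³ ≤ ‖u(0)‖₂ 2^{3q/2} ∫_{t₀}^{t₁} Π_{q..q+N−1}` at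
infinitely many `q`) and the band-flux CEILING L17 (`BandFluxCeiling.band_flux_le`: `∫_s^t Π_B ≤ 8‖u(0)‖₂²` for every
band and window) read together in the ATLAS's own currency — the fraction of the energy flux crossing one dyadic scale
that also crosses the next (`η` per octave, `λ = 2`):

* `pass_on_floor` (**L17′ — THE PASS-ON FLOOR**) — write `Φ(q, N, t₁) = ∫_{t₀}^{t₁} Π_{q..q+N−1}(u) dτ`. For every
  maximal smooth Leray–Hopf solution, every `t₀ ∈ (0, T)` and every `η̄ ≥ 0` with `2√2 · η̄ < 1` (`η̄ < 2^{-3/2} ≈ 0.354`):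
  at INFINITELY MANY levels `q` there are `N` and `t₁ ∈ (t₀, T)` with `η̄ · Φ(q, N+1, t₁) < Φ(q+1, N, t₁)` — of the
  energy flux crossing the scale `2^q` into the band `{q, …, q+N}` over the window (what level `q` keeps, `−∫ N_q`, plus
  what crosses `2^{q+1}`, `Φ(q+1, N, t₁)`), MORE than the fraction `η̄` crosses `2^{q+1}`. Equivalently: a cascade whose
  per-octave pass-on fraction stays `≤ η̄ < 2^{-3/2}` at all levels `q ≥ Q`, over all bands and all windows of a terminal
  window, is impossible — by induction on the ceiling the flux into `{q, …}` would decay like `η̄^{q−Q} · 8‖u₀‖₂²`,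
  against L16′'s floor `κ ν³ 2^{-3q/2}/‖u₀‖₂`, and `(2^{3/2} η̄)^q → 0`.
  CURRENCY NOTE (honest): this `η` is the windowed Littlewood–Paley FLUX pass-on per octave (`λ = 2`); the threshold
  `2^{-3/2}` sits between the spec sheet's energy-currency floor `η > λ^{-3} = 1/8` (sup² divergence) and Tao's summability
  `η* = 1/λ = 1/2`, and its exponent `3/2` is inherited from the energy-class bound `sup_t ‖Δ̇_q u‖_∞ ≤ C 2^{3q/2}‖u₀‖₂`
  behind L16′ — a necessity number, not a sharp constant, and NOT the scorer's band-energy `η` of a designed field at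
  its peak time. Necessity only; nothing about sufficiency.
* `pass_on_floor_octaves` (**L17″**, appended) — the same across `m` octaves (`λ = 2^m`): for every `m ≥ 1` and
  `η̄ ≥ 0` with `(2√2)^m η̄ < 1` (`η̄ < λ^{-3/2}`; `1/8` at `λ = 4`), at infinitely many `q` some `N, t₁` have
  `η̄ · Φ(q, N+m, t₁) < Φ(q+m, N, t₁)` (induction from every base `b ≥ Q` in steps of `m`, `q = Q + r + n m`).

0 sorry; no new definitions, no named facts (inputs: `BandFluxCeiling.band_flux_le`, `ForwardFluxFloor.forward_flux_floor`).

## References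

* A. Cheskidov, R. Shvydkoy, Arch. Ration. Mech. Anal. 195 (2010) 159–169, Lemma 3.2 (proof, (8)). [CheskidovShvydkoy2010]
* T. Tao, J. Amer. Math. Soc. 29 (2016) 601–674 (the cascade / summability dictionary `η* = 1/λ`). [Tao2016AveragedNS]
-/

noncomputable section

open MeasureTheory Set Function Filter Topology
open scoped ENNReal NNReal RealInnerProductSpace
open Literature.Analysis.FluidPDE Literature.Analysis.FunctionSpaces
open Summit.NavierStokesRegularity.FluidComputer.BandFluxCeiling

namespace Summit.NavierStokesRegularity.FluidComputer.FluxPassOnFloor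

/-! ## L17′ — the pass-on (η) floor -/

/-- **L17′ — THE PASS-ON (η) FLOOR OF A BLOW-UP.** Write `Φ(q, N, t₁) = ∫_{t₀}^{t₁} Π_{q..q+N−1}(u) dτ
= −∑_{k<N} ∫_{t₀}^{t₁} N_{q+k}(u(τ)) dτ` for the net energy flux into the band `{q, …, q+N−1}` over `[t₀, t₁]`. For every
maximal smooth solution `(u, p)` of the unforced Navier–Stokes system on `ℝ³ × [0, T)` (`ν > 0`) which is Leray–Hopf
from `u 0`, every `t₀ ∈ (0, T)` and every `η̄ ≥ 0` with `2√2 · η̄ < 1` (i.e. `η̄ < 2^{-3/2} ≈ 0.354`): at INFINITELY MANY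
levels `q` there are `N` and `t₁ ∈ (t₀, T)` with `η̄ · Φ(q, N+1, t₁) < Φ(q+1, N, t₁)` — of the flux crossing the scale
`2^q` over the window (what level `q` keeps, `−∫ N_q`, plus what crosses `2^{q+1}`, `Φ(q+1, N, t₁)`), MORE than the
fraction `η̄` crosses `2^{q+1}`. Proof: otherwise from some level `Q` on every octave passes on at most the fraction
`η̄` over every band and window; by induction `Φ(Q+n, N, t₁) ≤ η̄ⁿ Φ(Q, N+n, t₁) ≤ η̄ⁿ · 8‖u(0)‖₂²` (`band_flux_le`), while
L16′ (`ForwardFluxFloor.forward_flux_floor`) gives `κ ν³ ≤ ‖u(0)‖₂ 2^{3q/2} Φ(q, N, t₁)` at infinitely many `q` — and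
`(2^{3/2} η̄)^q → 0`. Reading: a cascade cannot be UNIFORMLY LEAKY — a per-octave pass-on fraction `≤ η̄ < 2^{-3/2}`
at all high levels is incompatible with blow-up; the exponent `3/2` is the energy-class exponent of L16′ (windowed
Littlewood–Paley flux currency; necessity only, nothing about sufficiency). [cite: CheskidovShvydkoy2010, Lemma 3.2 (proof, (8))] -/
theorem pass_on_floor {ν T : ℝ} (hν : 0 < ν) (hT : 0 < T)
    {u : ℝ → EuclideanSpace ℝ (Fin 3) → EuclideanSpace ℝ (Fin 3)} {p : ℝ → EuclideanSpace ℝ (Fin 3) → ℝ}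
    (hmax : IsMaximalSmoothSolution ν 0 u p T) (hLH : IsLerayHopfOn T ν 0 (u 0) u)
    {t₀ : ℝ} (ht₀ : t₀ ∈ Ioo 0 T) {η : ℝ} (hη0 : 0 ≤ η) (hη : 2 * Real.sqrt 2 * η < 1) :
    ∃ᶠ q : ℕ in atTop, ∃ (N : ℕ) (t₁ : ℝ), t₁ ∈ Ioo t₀ T ∧
      η * -∑ k ∈ Finset.range (N + 1), (∫ τ in t₀..t₁,
          ∫ x, ⟪blockFn ((q + k : ℕ) : ℤ) (u τ) x, blockFn ((q + k : ℕ) : ℤ) (convect (u τ) (u τ)) x⟫) <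
        -∑ k ∈ Finset.range N, (∫ τ in t₀..t₁,
          ∫ x, ⟪blockFn ((q + 1 + k : ℕ) : ℤ) (u τ) x, blockFn ((q + 1 + k : ℕ) : ℤ) (convect (u τ) (u τ)) x⟫) := by
  classical
  -- the windowed band flux as a function of (level, length, window end)
  set Φ : ℕ → ℕ → ℝ → ℝ := fun q N t₁ => -∑ k ∈ Finset.range N, (∫ τ in t₀..t₁,
    ∫ x, ⟪blockFn ((q + k : ℕ) : ℤ) (u τ) x, blockFn ((q + k : ℕ) : ℤ) (convect (u τ) (u τ)) x⟫) with hΦ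
  set E : ℝ := (eLpNorm (u 0) 2 volume).toReal with hE
  have hE0 : 0 ≤ E := ENNReal.toReal_nonneg
  -- the ceiling on every band `{q, …, q+N-1}` and window
  have hceil : ∀ (q N : ℕ) (t₁ : ℝ), t₁ ∈ Ioo t₀ T → Φ q N t₁ ≤ 8 * E ^ 2 := by
    intro q N t₁ ht₁
    have hinj : ∀ a ∈ Finset.range N, ∀ b ∈ Finset.range N,
        ((q + a : ℕ) : ℤ) = ((q + b : ℕ) : ℤ) → a = b := fun a _ b _ h => by simpa using h
    have h := band_flux_le hν hT hmax hLH ht₀.1 ht₁.1.le ht₁.2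
      ((Finset.range N).image (fun k : ℕ => ((q + k : ℕ) : ℤ)))
    rw [Finset.sum_image hinj] at h
    exact h
  by_contra hcon
  rw [Filter.not_frequently] at hcon
  obtain ⟨Q, hQ⟩ := Filter.eventually_atTop.1 hcon
  -- from level `Q` on, every octave passes on at most the fraction `η`
  have hstep : ∀ q, Q ≤ q → ∀ (N : ℕ) (t₁ : ℝ), t₁ ∈ Ioo t₀ T → Φ (q + 1) N t₁ ≤ η * Φ q (N + 1) t₁ := by
    intro q hq N t₁ ht₁
    exact not_lt.1 fun hlt => hQ q hq ⟨N, t₁, ht₁, hlt⟩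
  -- induction: `Φ (Q+n) N t₁ ≤ η^n Φ Q (N+n) t₁`
  have hind : ∀ (n N : ℕ) (t₁ : ℝ), t₁ ∈ Ioo t₀ T → Φ (Q + n) N t₁ ≤ η ^ n * Φ Q (N + n) t₁ := by
    intro n
    induction n with
    | zero => intro N t₁ _; simp
    | succ n ih =>
        intro N t₁ ht₁
        calc Φ (Q + (n + 1)) N t₁ = Φ (Q + n + 1) N t₁ := rfl
          _ ≤ η * Φ (Q + n) (N + 1) t₁ := hstep (Q + n) (Nat.le_add_right Q n) N t₁ ht₁
          _ ≤ η * (η ^ n * Φ Q (N + 1 + n) t₁) := mul_le_mul_of_nonneg_left (ih (N + 1) t₁ ht₁) hη0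
          _ = η ^ (n + 1) * Φ Q (N + (n + 1)) t₁ := by rw [show N + 1 + n = N + (n + 1) by omega]; ring
  have hdecay : ∀ q, Q ≤ q → ∀ (N : ℕ) (t₁ : ℝ), t₁ ∈ Ioo t₀ T → Φ q N t₁ ≤ η ^ (q - Q) * (8 * E ^ 2) := by
    intro q hq N t₁ ht₁
    have h := hind (q - Q) N t₁ ht₁
    rw [Nat.add_sub_cancel' hq] at h
    exact h.trans (mul_le_mul_of_nonneg_left (hceil Q _ t₁ ht₁) (pow_nonneg hη0 _))
  -- the forward-flux floor L16′ at infinitely many levels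
  obtain ⟨κ, hκ, H16⟩ := ForwardFluxFloor.forward_flux_floor
  have hfreq := H16 ν T hν hT u p hmax hLH t₀ ht₀
  -- eventually the decayed ceiling is below the floor
  set r : ℝ := 2 * Real.sqrt 2 * η with hr
  have hr0 : 0 ≤ r := by positivity
  have hpow : ∀ q : ℕ, (2 : ℝ) ^ q * Real.sqrt ((2 : ℝ) ^ q) = (2 * Real.sqrt 2) ^ q := by
    intro q
    have h2q : (0 : ℝ) ≤ (2 : ℝ) ^ q := by positivity
    rw [← sq_eq_sq₀ (by positivity) (by positivity)]
    simp only [mul_pow]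
    rw [Real.sq_sqrt h2q, pow_right_comm (Real.sqrt 2) q 2, Real.sq_sqrt (by norm_num : (0 : ℝ) ≤ 2)]
  have hev : ∀ᶠ q : ℕ in atTop, Q ≤ q ∧
      E * ((2 : ℝ) ^ q * Real.sqrt ((2 : ℝ) ^ q)) * (η ^ (q - Q) * (8 * E ^ 2)) < κ * ν ^ 3 := by
    have hlim : Tendsto (fun q : ℕ => (8 * E ^ 3 * (2 * Real.sqrt 2) ^ Q) * r ^ (q - Q)) atTop (𝓝 0) := by
      have h := ((tendsto_pow_atTop_nhds_zero_of_lt_one hr0 hη).comp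
        (tendsto_sub_atTop_nat Q)).const_mul (8 * E ^ 3 * (2 * Real.sqrt 2) ^ Q)
      rw [mul_zero] at h
      exact h
    have hκν : (0 : ℝ) < κ * ν ^ 3 := by positivity
    refine ((eventually_ge_atTop Q).and (hlim.eventually_lt_const hκν)).mono fun q hq => ⟨hq.1, ?_⟩
    have heq : E * ((2 : ℝ) ^ q * Real.sqrt ((2 : ℝ) ^ q)) * (η ^ (q - Q) * (8 * E ^ 2)) =
        (8 * E ^ 3 * (2 * Real.sqrt 2) ^ Q) * r ^ (q - Q) := by
      have h22 : (2 * Real.sqrt 2) ^ q = (2 * Real.sqrt 2) ^ Q * (2 * Real.sqrt 2) ^ (q - Q) := by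
        rw [← pow_add, Nat.add_sub_cancel' hq.1]
      rw [hpow q, h22, hr, mul_pow (2 * Real.sqrt 2) η (q - Q)]
      ring
    rw [heq]
    exact hq.2
  obtain ⟨q, ⟨N, t₁, ht₁, hfloor⟩, hqQ, hlt⟩ := (hfreq.and_eventually hev).exists
  have hΦle : Φ q N t₁ ≤ η ^ (q - Q) * (8 * E ^ 2) := hdecay q hqQ N t₁ ht₁
  have hchain : κ * ν ^ 3 ≤ E * ((2 : ℝ) ^ q * Real.sqrt ((2 : ℝ) ^ q)) * (η ^ (q - Q) * (8 * E ^ 2)) :=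
    hfloor.trans (mul_le_mul_of_nonneg_left hΦle (by positivity))
  exact absurd (hchain.trans_lt hlt) (lt_irrefl _)

/-! ## L17″ — the pass-on floor across `m` octaves (`λ = 2^m`) -/

/-- **L17″ — THE PASS-ON FLOOR ACROSS `m` OCTAVES (`λ = 2^m`).** Same setting and notation as `pass_on_floor`
(`Φ(q, N, t₁) = ∫_{t₀}^{t₁} Π_{q..q+N−1}(u) dτ`). For every `m ≥ 1` and every `η̄ ≥ 0` with `(2√2)^m · η̄ < 1` (i.e.
`η̄ < λ^{-3/2}`, `λ = 2^m`; `η̄ < 1/8` for `λ = 4`): at INFINITELY MANY levels `q` there are `N` and `t₁ ∈ (t₀, T)` with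
`η̄ · Φ(q, N+m, t₁) < Φ(q+m, N, t₁)` — of the energy flux crossing the scale `2^q` into `{q, …, q+N+m−1}` over the window,
MORE than the fraction `η̄` crosses the scale `2^{q+m}`, `m` octaves up. Proof: otherwise from some level `Q` on every
`m`-octave step passes on at most `η̄`; by induction from every base `b ≥ Q`, `Φ(b+nm, N, t₁) ≤ η̄ⁿ Φ(b, N+nm, t₁) ≤ η̄ⁿ ·
8‖u(0)‖₂²` (`BandFluxCeiling.band_flux_le`); writing `q = Q + r + n m` (`r < m`) the flux into `{q, …}` is
`≤ 8‖u₀‖₂² η̄^{⌊(q−Q)/m⌋}`, while L16′ gives `κν³ ≤ ‖u₀‖₂ (2√2)^q Φ(q, N, t₁)` infinitely often and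
`(2√2)^q η̄^{⌊(q−Q)/m⌋} ≤ (2√2)^{Q+m} ((2√2)^m η̄)^{⌊(q−Q)/m⌋} → 0`. The atlas's `λ = 4` rows read against `m = 2`
(threshold `1/8`), `λ = 2` against `pass_on_floor` (`2^{-3/2}`); windowed Littlewood–Paley flux currency, necessity only.
[cite: CheskidovShvydkoy2010, Lemma 3.2 (proof, (8))] -/
theorem pass_on_floor_octaves {ν T : ℝ} (hν : 0 < ν) (hT : 0 < T)
    {u : ℝ → EuclideanSpace ℝ (Fin 3) → EuclideanSpace ℝ (Fin 3)} {p : ℝ → EuclideanSpace ℝ (Fin 3) → ℝ}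
    (hmax : IsMaximalSmoothSolution ν 0 u p T) (hLH : IsLerayHopfOn T ν 0 (u 0) u)
    {t₀ : ℝ} (ht₀ : t₀ ∈ Ioo 0 T) {m : ℕ} (hm : 0 < m) {η : ℝ} (hη0 : 0 ≤ η)
    (hη : (2 * Real.sqrt 2) ^ m * η < 1) :
    ∃ᶠ q : ℕ in atTop, ∃ (N : ℕ) (t₁ : ℝ), t₁ ∈ Ioo t₀ T ∧
      η * -∑ k ∈ Finset.range (N + m), (∫ τ in t₀..t₁,
          ∫ x, ⟪blockFn ((q + k : ℕ) : ℤ) (u τ) x, blockFn ((q + k : ℕ) : ℤ) (convect (u τ) (u τ)) x⟫) <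
        -∑ k ∈ Finset.range N, (∫ τ in t₀..t₁,
          ∫ x, ⟪blockFn ((q + m + k : ℕ) : ℤ) (u τ) x, blockFn ((q + m + k : ℕ) : ℤ) (convect (u τ) (u τ)) x⟫) := by
  classical
  set Φ : ℕ → ℕ → ℝ → ℝ := fun q N t₁ => -∑ k ∈ Finset.range N, (∫ τ in t₀..t₁,
    ∫ x, ⟪blockFn ((q + k : ℕ) : ℤ) (u τ) x, blockFn ((q + k : ℕ) : ℤ) (convect (u τ) (u τ)) x⟫) with hΦ
  set E : ℝ := (eLpNorm (u 0) 2 volume).toReal with hE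
  have hE0 : 0 ≤ E := ENNReal.toReal_nonneg
  have hceil : ∀ (q N : ℕ) (t₁ : ℝ), t₁ ∈ Ioo t₀ T → Φ q N t₁ ≤ 8 * E ^ 2 := by
    intro q N t₁ ht₁
    have hinj : ∀ a ∈ Finset.range N, ∀ b ∈ Finset.range N,
        ((q + a : ℕ) : ℤ) = ((q + b : ℕ) : ℤ) → a = b := fun a _ b _ h => by simpa using h
    have h := band_flux_le hν hT hmax hLH ht₀.1 ht₁.1.le ht₁.2
      ((Finset.range N).image (fun k : ℕ => ((q + k : ℕ) : ℤ)))
    rw [Finset.sum_image hinj] at h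
    exact h
  by_contra hcon
  rw [Filter.not_frequently] at hcon
  obtain ⟨Q, hQ⟩ := Filter.eventually_atTop.1 hcon
  have hstep : ∀ q, Q ≤ q → ∀ (N : ℕ) (t₁ : ℝ), t₁ ∈ Ioo t₀ T → Φ (q + m) N t₁ ≤ η * Φ q (N + m) t₁ := by
    intro q hq N t₁ ht₁
    exact not_lt.1 fun hlt => hQ q hq ⟨N, t₁, ht₁, hlt⟩
  -- induction from every base `b ≥ Q`: `Φ (b + n m) N t₁ ≤ η^n Φ b (N + n m) t₁`
  have hind : ∀ (n b : ℕ), Q ≤ b → ∀ (N : ℕ) (t₁ : ℝ), t₁ ∈ Ioo t₀ T →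
      Φ (b + n * m) N t₁ ≤ η ^ n * Φ b (N + n * m) t₁ := by
    intro n
    induction n with
    | zero => intro b _ N t₁ _; simp
    | succ n ih =>
        intro b hb N t₁ ht₁
        have h1 : b + (n + 1) * m = b + n * m + m := by ring
        have h2 : N + m + n * m = N + (n + 1) * m := by ring
        calc Φ (b + (n + 1) * m) N t₁ = Φ (b + n * m + m) N t₁ := by rw [h1]
          _ ≤ η * Φ (b + n * m) (N + m) t₁ := hstep (b + n * m) (hb.trans (Nat.le_add_right b _)) N t₁ ht₁
          _ ≤ η * (η ^ n * Φ b (N + m + n * m) t₁) := mul_le_mul_of_nonneg_left (ih b hb (N + m) t₁ ht₁) hη0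
          _ = η ^ (n + 1) * Φ b (N + (n + 1) * m) t₁ := by rw [h2]; ring
  have hdecay : ∀ q, Q ≤ q → ∀ (N : ℕ) (t₁ : ℝ), t₁ ∈ Ioo t₀ T →
      Φ q N t₁ ≤ η ^ ((q - Q) / m) * (8 * E ^ 2) := by
    intro q hq N t₁ ht₁
    set n : ℕ := (q - Q) / m with hn
    set r : ℕ := (q - Q) % m with hr
    have hqr : q = Q + r + n * m := by
      have h1 : Q + (q - Q) = q := Nat.add_sub_cancel' hq
      have h2 : m * n + r = q - Q := Nat.div_add_mod (q - Q) m
      rw [← h1, ← h2]; ring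
    have h := hind n (Q + r) (Nat.le_add_right Q r) N t₁ ht₁
    rw [← hqr] at h
    exact h.trans (mul_le_mul_of_nonneg_left (hceil (Q + r) _ t₁ ht₁) (pow_nonneg hη0 _))
  -- the forward-flux floor L16′ at infinitely many levels
  obtain ⟨κ, hκ, H16⟩ := ForwardFluxFloor.forward_flux_floor
  have hfreq := H16 ν T hν hT u p hmax hLH t₀ ht₀
  -- eventually the decayed ceiling is below the floor
  set ρ : ℝ := (2 * Real.sqrt 2) ^ m * η with hρ
  have hρ0 : 0 ≤ ρ := by positivity
  have h22 : (1 : ℝ) ≤ 2 * Real.sqrt 2 := by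
    have := Real.one_lt_sqrt_two
    linarith
  have hpow : ∀ q : ℕ, (2 : ℝ) ^ q * Real.sqrt ((2 : ℝ) ^ q) = (2 * Real.sqrt 2) ^ q := by
    intro q
    have h2q : (0 : ℝ) ≤ (2 : ℝ) ^ q := by positivity
    rw [← sq_eq_sq₀ (by positivity) (by positivity)]
    simp only [mul_pow]
    rw [Real.sq_sqrt h2q, pow_right_comm (Real.sqrt 2) q 2, Real.sq_sqrt (by norm_num : (0 : ℝ) ≤ 2)]
  set C : ℝ := 8 * E ^ 3 * (2 * Real.sqrt 2) ^ (Q + m) with hC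
  have hC0 : 0 ≤ C := by positivity
  have hκν : (0 : ℝ) < κ * ν ^ 3 := by positivity
  have hlim : Tendsto (fun n : ℕ => C * ρ ^ n) atTop (𝓝 0) := by
    have h := (tendsto_pow_atTop_nhds_zero_of_lt_one hρ0 hη).const_mul C
    rw [mul_zero] at h
    exact h
  obtain ⟨n₀, hn₀⟩ := eventually_atTop.1 (hlim.eventually_lt_const hκν)
  -- for `q ≥ Q + m n₀`: the bound `E (2√2)^q η^{(q-Q)/m} 8E² ≤ C ρ^{(q-Q)/m} < κ ν³`
  have hbound : ∀ q, Q ≤ q →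
      E * ((2 : ℝ) ^ q * Real.sqrt ((2 : ℝ) ^ q)) * (η ^ ((q - Q) / m) * (8 * E ^ 2)) ≤ C * ρ ^ ((q - Q) / m) := by
    intro q hq
    set n : ℕ := (q - Q) / m with hn
    have hlt : q - Q < m * (n + 1) := by
      have := Nat.lt_div_mul_add (a := q - Q) hm
      rw [← hn] at this
      linarith [Nat.mul_comm (n + 1) m]
    have hle : (2 * Real.sqrt 2) ^ q ≤ (2 * Real.sqrt 2) ^ (Q + m) * ((2 * Real.sqrt 2) ^ m) ^ n := by
      calc (2 * Real.sqrt 2) ^ q = (2 * Real.sqrt 2) ^ Q * (2 * Real.sqrt 2) ^ (q - Q) := by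
            rw [← pow_add, Nat.add_sub_cancel' hq]
        _ ≤ (2 * Real.sqrt 2) ^ Q * (2 * Real.sqrt 2) ^ (m * (n + 1)) :=
            mul_le_mul_of_nonneg_left (pow_le_pow_right₀ h22 hlt.le) (by positivity)
        _ = (2 * Real.sqrt 2) ^ (Q + m) * ((2 * Real.sqrt 2) ^ m) ^ n := by
            rw [← pow_mul, pow_add, show m * (n + 1) = m * n + m by ring, pow_add]; ring
    calc E * ((2 : ℝ) ^ q * Real.sqrt ((2 : ℝ) ^ q)) * (η ^ n * (8 * E ^ 2))
        = 8 * E ^ 3 * (2 * Real.sqrt 2) ^ q * η ^ n := by rw [hpow q]; ring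
      _ ≤ 8 * E ^ 3 * ((2 * Real.sqrt 2) ^ (Q + m) * ((2 * Real.sqrt 2) ^ m) ^ n) * η ^ n := by
          gcongr
      _ = C * ρ ^ n := by rw [hC, hρ, mul_pow]; ring
  have hev : ∀ᶠ q : ℕ in atTop, Q ≤ q ∧
      E * ((2 : ℝ) ^ q * Real.sqrt ((2 : ℝ) ^ q)) * (η ^ ((q - Q) / m) * (8 * E ^ 2)) < κ * ν ^ 3 := by
    refine eventually_atTop.2 ⟨Q + m * n₀, fun q hq => ?_⟩
    have hQq : Q ≤ q := le_trans (Nat.le_add_right Q _) hq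
    refine ⟨hQq, (hbound q hQq).trans_lt (hn₀ _ ?_)⟩
    exact (Nat.le_div_iff_mul_le hm).2 (by rw [Nat.mul_comm]; omega)
  obtain ⟨q, ⟨N, t₁, ht₁, hfloor⟩, hqQ, hlt⟩ := (hfreq.and_eventually hev).exists
  have hΦle : Φ q N t₁ ≤ η ^ ((q - Q) / m) * (8 * E ^ 2) := hdecay q hqQ N t₁ ht₁
  have hchain : κ * ν ^ 3 ≤ E * ((2 : ℝ) ^ q * Real.sqrt ((2 : ℝ) ^ q)) * (η ^ ((q - Q) / m) * (8 * E ^ 2)) :=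
    hfloor.trans (mul_le_mul_of_nonneg_left hΦle (by positivity))
  exact absurd (hchain.trans_lt hlt) (lt_irrefl _)

end Summit.NavierStokesRegularity.FluidComputer.FluxPassOnFloor

end
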